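import Literature.Computability.MetaComplexity.HierarchicalParity
import HarnessLib

/-!
# Hierarchical parity formulas, II: combining two parities inside bounded-depth Frege

Second layer of the depth-dependent bounded-depth Frege upper bound for linear algebra over `𝔽₂`
(`DepthFregeGaussianElimination.lean`). For the hierarchical parity formulas `hp a T j b c`
(`HierarchicalParity.lean`) we derive, in the bounded-derivation calculus `TextbookFrege.BD`, the
COMBINATION sequents

  `comb a T T' j b e e' = ⊢ ¬hp T j b e, ¬hp T' j b e', hp (T ∆ T') j b (e ⊕ e')`

("parity of `T` is `e` and parity of `T'` is `e'` imply parity of `T ∆ T'` is `e ⊕ e'`, blockwise")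
for ALL `b`, by induction on the level `j` (`combS`):

* level `0`: a truth table over the `≤ 1` variable of the block;
* level `j + 1`: the propositional SKELETON of the step — the same sequent with the `6a` children
  formulas replaced by variables (`combSkel`), a tautology over `6a` variables (`combSkel_taut`)
  derived by a truth table of `2^{O(a)}` lines (`tautSeqW`) — is instantiated by the substitution
  `combSubst` of the children formulas (`substProofBD`: sizes multiply by `hsz a j`, depths add
  `2j + 3`), and its `4a` negated children facts are cut away against the level-`j` sequents
  (`elimAllN`). Lines: `combLines a j = (4a)^j · 2^{O(a)}`; sizes `combB a j`; disjunct depth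
  `2j + 16`.

All statements are proved. The step is the formula-level analogue of one XOR of two equations in
Gaussian elimination; the skeleton/substitution organisation is that of Galesi et al. 2023, §3–4.

References: N. Galesi, D. Itsykson, A. Riazanov, A. Sofronova, APAL 174 (2023), Lemma 4, §3.1
(substitutions in bounded-depth proofs), §4; J. Håstad, J. ACM 68 (2021), §1.
-/

namespace Literature.Computability.MetaComplexity

open Complexity Complexity.PropForm TextbookFrege KrajicekRamsey Finset Complexity.Stockmeyer

namespace HierParity

/-! ### The skeleton of the combination step -/

/-- Skeleton variable: child `r`, slot `t ∈ {0, 1, 2}` (for `T`, `T'`, `T ∆ T'`), bit `e`. [folklore] -/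
def sv (r t : ℕ) (e : Bool) : ℕ :=
  6 * r + (2 * t + (if e then 1 else 0))

variable (a : ℕ)

/-- Skeleton of a level-`(j+1)` formula over slot `t`: the children formulas are variables.
[folklore] -/
noncomputable def skel (t : ℕ) (c : Bool) : PropForm ℕ :=
  disjList ((bvecs a c).map fun cs =>
    conjList ((List.finRange a).map fun r : Fin a => var (sv r t (cs r))))

/-- Skeleton of a child fact `¬A_{r,e} ∨ ¬B_{r,e'} ∨ C_{r,e ⊕ e'}`. [folklore] -/
def cfSkel (r : ℕ) (e e' : Bool) : PropForm ℕ :=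
  disjList [neg (var (sv r 0 e)), neg (var (sv r 1 e')), var (sv r 2 (xor e e'))]

/-- The four child facts of child `r`. [folklore] -/
def cfFour (r : ℕ) : List (PropForm ℕ) :=
  [cfSkel r false false, cfSkel r false true, cfSkel r true false, cfSkel r true true]

/-- All `4a` child facts. [folklore] -/
def cfList : List (PropForm ℕ) :=
  (List.finRange a).flatMap fun r : Fin a => cfFour r

/-- **The skeleton sequent** of the combination step: the negated child facts, `¬skel₀ c`,
`¬skel₁ c'`, `skel₂ (c ⊕ c')`. [folklore] -/
noncomputable def combSkel (c c' : Bool) : List (PropForm ℕ) :=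
  (cfList a).map neg ++ [neg (skel a 0 c), neg (skel a 1 c'), skel a 2 (xor c c')]

variable {a}

/-- Semantics of a skeleton formula. [folklore] -/
theorem eval_skel (τ : ℕ → Bool) (t : ℕ) (c : Bool) :
    (skel a t c).eval τ = true ↔ ∃ cs ∈ bvecs a c, ∀ r : Fin a, τ (sv r t (cs r)) = true := by
  rw [skel, eval_disjList]
  constructor
  · rintro ⟨A, hA, hAτ⟩
    obtain ⟨cs, hcs, rfl⟩ := List.mem_map.1 hA
    rw [eval_conjList] at hAτ
    exact ⟨cs, hcs, fun r => by
      simpa [eval] using hAτ _ (List.mem_map.2 ⟨r, List.mem_finRange r, rfl⟩)⟩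
  · rintro ⟨cs, hcs, hτ⟩
    refine ⟨_, List.mem_map.2 ⟨cs, hcs, rfl⟩, ?_⟩
    rw [eval_conjList]
    intro A hA
    obtain ⟨r, -, rfl⟩ := List.mem_map.1 hA
    simpa [eval] using hτ r

/-- Semantics of a child fact. [folklore] -/
theorem eval_cfSkel (τ : ℕ → Bool) (r : ℕ) (e e' : Bool) (h : (cfSkel r e e').eval τ = true)
    (h0 : τ (sv r 0 e) = true) (h1 : τ (sv r 1 e') = true) : τ (sv r 2 (xor e e')) = true := by
  simp only [cfSkel, disjList_cons, disjList_nil, eval, h0, h1, Bool.not_true, Bool.false_or,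
    Bool.or_false] at h
  exact h

/-- Membership in the list of child facts. [folklore] -/
theorem cfSkel_mem_cfList (r : Fin a) (e e' : Bool) : cfSkel r e e' ∈ cfList a := by
  rw [cfList, List.mem_flatMap]
  refine ⟨r, List.mem_finRange r, ?_⟩
  cases e <;> cases e' <;> simp [cfFour]

/-- Members of the list of child facts. [folklore] -/
theorem mem_cfList {X : PropForm ℕ} (h : X ∈ cfList a) : ∃ (r : Fin a) (e e' : Bool), X = cfSkel r e e' := by
  rw [cfList, List.mem_flatMap] at h
  obtain ⟨r, -, h⟩ := h
  simp only [cfFour, List.mem_cons, List.not_mem_nil, or_false] at h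
  rcases h with rfl | rfl | rfl | rfl
  exacts [⟨r, _, _, rfl⟩, ⟨r, _, _, rfl⟩, ⟨r, _, _, rfl⟩, ⟨r, _, _, rfl⟩]

/-- The list of child facts has `4a` members. [folklore] -/
theorem length_cfList : (cfList a).length = 4 * a := by
  rw [cfList, List.length_flatMap]
  simp [cfFour, List.sum_replicate, Nat.mul_comm]

/-- **The skeleton sequent is a tautology.** [folklore] -/
theorem combSkel_taut (c c' : Bool) (τ : ℕ → Bool) : ∃ A ∈ combSkel a c c', A.eval τ = true := by
  by_cases hcf : ∀ X ∈ cfList a, X.eval τ = true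
  swap
  · push Not at hcf
    obtain ⟨X, hX, hXτ⟩ := hcf
    exact ⟨neg X, List.mem_append_left _ (List.mem_map.2 ⟨X, hX, rfl⟩), by simpa [eval] using hXτ⟩
  by_cases h0 : (skel a 0 c).eval τ = true
  swap
  · exact ⟨neg (skel a 0 c), List.mem_append_right _ (by simp), by simpa [eval] using h0⟩
  by_cases h1 : (skel a 1 c').eval τ = true
  swap
  · exact ⟨neg (skel a 1 c'), List.mem_append_right _ (by simp), by simpa [eval] using h1⟩
  refine ⟨skel a 2 (xor c c'), List.mem_append_right _ (by simp), ?_⟩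
  obtain ⟨cs, hcs, hτ⟩ := (eval_skel τ 0 c).1 h0
  obtain ⟨cs', hcs', hτ'⟩ := (eval_skel τ 1 c').1 h1
  refine (eval_skel τ 2 (xor c c')).2 ⟨fun r => xor (cs r) (cs' r), ?_, fun r => ?_⟩
  · rw [mem_bvecs, bz_xor]
    rw [mem_bvecs] at hcs hcs'
    simp only [bz_xor, sum_add_distrib, hcs, hcs']
  · exact eval_cfSkel τ r (cs r) (cs' r) (hcf _ (cfSkel_mem_cfList r _ _)) (hτ r) (hτ' r)

/-! ### Syntactic facts about the skeleton -/

/-- Skeleton variables are `< 6a`. [folklore] -/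
theorem sv_lt {r t : ℕ} (hr : r < a) (ht : t ≤ 2) (e : Bool) : sv r t e < 6 * a := by
  unfold sv; split_ifs <;> omega

/-- Variables of a skeleton formula. [folklore] -/
theorem mem_vars_skel {t : ℕ} (ht : t ≤ 2) {c : Bool} {x : ℕ} (hx : x ∈ (skel a t c).vars) : x < 6 * a := by
  rw [skel] at hx
  obtain ⟨A, hA, hx⟩ := mem_vars_disjList hx
  obtain ⟨cs, -, rfl⟩ := List.mem_map.1 hA
  obtain ⟨B, hB, hx⟩ := mem_vars_conjList hx
  obtain ⟨r, -, rfl⟩ := List.mem_map.1 hB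
  simp only [PropForm.vars, Finset.mem_singleton] at hx
  subst hx
  exact sv_lt r.2 ht _

/-- Variables of a child fact. [folklore] -/
theorem mem_vars_cfSkel {r : ℕ} (hr : r < a) {e e' : Bool} {x : ℕ} (hx : x ∈ (cfSkel r e e').vars) :
    x < 6 * a := by
  simp only [cfSkel, disjList_cons, disjList_nil, PropForm.vars, Finset.mem_union,
    Finset.mem_singleton, Finset.notMem_empty, or_false] at hx
  rcases hx with rfl | rfl | rfl
  · exact sv_lt hr (by norm_num) _
  · exact sv_lt hr (by norm_num) _
  · exact sv_lt hr (by norm_num) _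

/-- Size of a child fact: `9`. [folklore] -/
theorem size_cfSkel (r : ℕ) (e e' : Bool) : (cfSkel r e e').size = 9 := by
  simp [cfSkel, size]

/-- Disjunct depth of a negated child fact: at most `3`. [folklore] -/
theorem dd_neg_cfSkel_le (r : ℕ) (e e' : Bool) : (neg (cfSkel r e e')).dd ≤ 3 := by
  rw [cfSkel]
  exact dd_neg_disjList_le (p := 1) fun X hX => by
    simp only [List.mem_cons, List.not_mem_nil, or_false] at hX
    rcases hX with rfl | rfl | rfl <;> simp

/-- Size of a skeleton formula: at most `2^a (2a + 2) + 1`. [folklore] -/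
theorem size_skel_le (t : ℕ) (c : Bool) : (skel a t c).size ≤ 2 ^ a * (2 * a + 2) + 1 := by
  rw [skel, size_disjList_eq_msum]
  have hmem : ∀ X ∈ (bvecs a c).map (fun cs => conjList ((List.finRange a).map
      fun r : Fin a => var (sv r t (cs r)))), X.size + 1 ≤ 2 * a + 2 := by
    intro X hX
    obtain ⟨cs, -, rfl⟩ := List.mem_map.1 hX
    rw [size_conjList_eq_msum]
    have h := msum_le_length_mul (W := 2)
      (L := (List.finRange a).map fun r : Fin a => var (sv r t (cs r))) fun Y hY => by
        obtain ⟨r, -, rfl⟩ := List.mem_map.1 hY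
        simp [size]
    rw [List.length_map, List.length_finRange] at h
    omega
  have h := msum_le_length_mul hmem
  rw [List.length_map] at h
  have hl := length_bvecs_le a c
  have := Nat.mul_le_mul_right (2 * a + 2) hl
  omega

/-- Disjunct depth of a skeleton formula: at most `3`. [folklore] -/
theorem dd_skel_le (t : ℕ) (c : Bool) : (skel a t c).dd ≤ 3 := by
  rw [skel]
  exact dd_disjList_le fun X hX => by
    obtain ⟨cs, -, rfl⟩ := List.mem_map.1 hX
    exact dd_conjList_le (p := 1) fun Y hY => by
      obtain ⟨r, -, rfl⟩ := List.mem_map.1 hY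
      simp

/-- Disjunct depth of a negated skeleton formula: at most `5`. [folklore] -/
theorem dd_neg_skel_le (t : ℕ) (c : Bool) : (neg (skel a t c)).dd ≤ 5 := by
  rw [skel]
  exact dd_neg_disjList_le (p := 3) fun X hX => by
    obtain ⟨cs, -, rfl⟩ := List.mem_map.1 hX
    exact dd_conjList_le (p := 1) fun Y hY => by
      obtain ⟨r, -, rfl⟩ := List.mem_map.1 hY
      simp

/-! ### A bounded derivation of the skeleton -/

/-- Member-sum budget of the skeleton sequent. [folklore] -/
def skelS (a : ℕ) : ℕ := 4 * a * 11 + 3 * (2 ^ a * (2 * a + 2) + 3)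

/-- Line count of the truth-table derivation of the skeleton sequent. [folklore] -/
def skelLines (a : ℕ) : ℕ :=
  2 ^ (6 * a) * (skelS a * (100 * (6 * a + 8) ^ 2) + 50 * (6 * a + (4 * a + 3) + 3) ^ 2 + 2)

/-- The size of a proof of the skeleton sequent: lines times line size. [folklore] -/
def skelPS (a : ℕ) : ℕ := skelLines a * (40 * (skelS a + 6 * a) + 200)

/-- **The skeleton sequent has a depth-`15` proof of size `≤ skelPS a`** (a truth table over its
`6a` variables). [cite: GalesiEtAl2023, Lemma 4] -/
theorem exists_proof_combSkel (c c' : Bool) : ∃ π : List (PropForm ℕ),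
    textbookFrege.IsDepthProofOf 15 π (disjList (combSkel a c c')) ∧ proofSize π ≤ skelPS a := by
  have hmsum : msum (combSkel a c c') ≤ skelS a := by
    rw [combSkel, msum_append]
    have h1 : msum ((cfList a).map neg) ≤ 4 * a * 11 := by
      have h := msum_le_length_mul (L := (cfList a).map neg) (W := 11) fun X hX => by
        obtain ⟨Y, hY, rfl⟩ := List.mem_map.1 hX
        obtain ⟨r, e, e', rfl⟩ := mem_cfList hY
        simp [size, size_cfSkel]
      rwa [List.length_map, length_cfList] at h
    have h2 := size_skel_le (a := a) 0 c
    have h3 := size_skel_le (a := a) 1 c'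
    have h4 := size_skel_le (a := a) 2 (xor c c')
    simp only [msum_cons, msum_nil, size, skelS]
    omega
  have hBD : BD 14 (40 * (skelS a + 6 * a) + 200) (skelLines a) (disjList (combSkel a c c')) := by
    refine tautSeqW (combSkel a c c') (List.range (6 * a)) (List.nodup_range) (N := 6 * a)
      (G := 4 * a + 3) (by simp) ?_ ?_ (combSkel_taut c c') (q := 6) ?_ hmsum (by norm_num) le_rfl
    · rw [combSkel, List.length_append, List.length_map, length_cfList]; simp
    · intro A hA x hx
      rw [List.mem_range]
      rw [combSkel, List.mem_append] at hA
      rcases hA with hA | hA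
      · obtain ⟨Y, hY, rfl⟩ := List.mem_map.1 hA
        obtain ⟨r, e, e', rfl⟩ := mem_cfList hY
        exact mem_vars_cfSkel r.2 (by simpa [PropForm.vars] using hx)
      · simp only [List.mem_cons, List.not_mem_nil, or_false] at hA
        rcases hA with rfl | rfl | rfl
        · exact mem_vars_skel (t := 0) (by norm_num) (by simpa [PropForm.vars] using hx)
        · exact mem_vars_skel (t := 1) (by norm_num) (by simpa [PropForm.vars] using hx)
        · exact mem_vars_skel (t := 2) (by norm_num) hx
    · intro A hA
      rw [combSkel, List.mem_append] at hA
      rcases hA with hA | hA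
      · obtain ⟨Y, hY, rfl⟩ := List.mem_map.1 hA
        obtain ⟨r, e, e', rfl⟩ := mem_cfList hY
        exact (altDepth_le_dd_succ _).trans (by have := dd_neg_cfSkel_le (r : ℕ) e e'; omega)
      · simp only [List.mem_cons, List.not_mem_nil, or_false] at hA
        rcases hA with rfl | rfl | rfl
        · exact (altDepth_le_dd_succ _).trans (by have := dd_neg_skel_le (a := a) 0 c; omega)
        · exact (altDepth_le_dd_succ _).trans (by have := dd_neg_skel_le (a := a) 1 c'; omega)
        · exact (altDepth_le_dd_succ _).trans (by have := dd_skel_le (a := a) 2 (xor c c'); omega)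
  obtain ⟨π, hπ, hsize⟩ := hBD.exists_isDepthProofOf
  exact ⟨π, hπ, hsize⟩

/-! ### The substitution realizing the skeleton -/

/-- The set of slot `t`: `T`, `T'`, `T ∆ T'`. [folklore] -/
def slotSet (T T' : Finset ℕ) : ℕ → Finset ℕ
  | 0 => T
  | 1 => T'
  | _ => symmDiff T T'

variable (a)

/-- **The substitution** of the children formulas of node `(j+1, b)` for the skeleton variables.
[folklore] -/
noncomputable def combSubst (T T' : Finset ℕ) (j b : ℕ) : ℕ → PropForm ℕ := fun x =>
  match x % 6 with
  | 0 => hp a T j (b * a + x / 6) false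
  | 1 => hp a T j (b * a + x / 6) true
  | 2 => hp a T' j (b * a + x / 6) false
  | 3 => hp a T' j (b * a + x / 6) true
  | 4 => hp a (symmDiff T T') j (b * a + x / 6) false
  | _ => hp a (symmDiff T T') j (b * a + x / 6) true

/-- **The combination formula** at node `(j, b)`: `¬hp T j b e ∨ ¬hp T' j b e' ∨ hp (T ∆ T') j b (e ⊕ e')`,
as a sequent. [folklore] -/
noncomputable def comb (T T' : Finset ℕ) (j b : ℕ) (e e' : Bool) : PropForm ℕ :=
  disjList [neg (hp a T j b e), neg (hp a T' j b e'), hp a (symmDiff T T') j b (xor e e')]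

variable {a} {T T' : Finset ℕ} {j b : ℕ}

/-- The substitution on skeleton variables. [folklore] -/
theorem combSubst_sv (r : ℕ) {t : ℕ} (ht : t ≤ 2) (e : Bool) :
    combSubst a T T' j b (sv r t e) = hp a (slotSet T T' t) j (b * a + r) e := by
  have hdiv : sv r t e / 6 = r := by
    unfold sv; rw [Nat.mul_add_div (by norm_num)]; split_ifs <;> omega
  have hmod : sv r t e % 6 = 2 * t + (if e then 1 else 0) := by
    unfold sv; rw [Nat.mul_add_mod]; split_ifs <;> omega
  unfold combSubst
  rw [hdiv, hmod]
  interval_cases t <;> cases e <;> rfl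

/-- Every substituted formula is a level-`j` hierarchical parity formula: size. [folklore] -/
theorem size_combSubst_le (x : ℕ) : (combSubst a T T' j b x).size ≤ hsz a j := by
  unfold combSubst; split <;> exact size_hp_le _ _ _ _

/-- Every substituted formula is a level-`j` hierarchical parity formula: auxiliary depth. [folklore] -/
theorem altDepthAux_combSubst_le (x t : ℕ) : altDepthAux t (combSubst a T T' j b x) ≤ 2 * j + 3 := by
  unfold combSubst; split <;> exact altDepthAux_hp_le _ _ _ _ _

/-- **The skeleton instantiates to the level-`(j+1)` formula.** [folklore] -/
theorem subst_skel {t : ℕ} (ht : t ≤ 2) (c : Bool) :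
    (skel a t c).subst (combSubst a T T' j b) = hp a (slotSet T T' t) (j + 1) b c := by
  rw [skel, subst_disjList, hp_succ, List.map_map]
  congr 1
  refine List.map_congr_left fun cs _ => ?_
  simp only [Function.comp, subst_conjList, List.map_map]
  congr 1
  refine List.map_congr_left fun r _ => ?_
  simp only [Function.comp, PropForm.subst]
  exact combSubst_sv r ht (cs r)

/-- **A child fact instantiates to the child's combination formula.** [folklore] -/
theorem subst_cfSkel (r : ℕ) (e e' : Bool) :
    (cfSkel r e e').subst (combSubst a T T' j b) = comb a T T' j (b * a + r) e e' := by
  simp only [cfSkel, comb, subst_disjList, List.map_cons, List.map_nil, PropForm.subst,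
    combSubst_sv r (show 0 ≤ 2 by norm_num), combSubst_sv r (show 1 ≤ 2 by norm_num),
    combSubst_sv r (show 2 ≤ 2 by norm_num)]
  rfl

/-- **The skeleton sequent instantiates** to: the negated children combination formulas, followed
by the parent's combination formula split into its three members. [folklore] -/
theorem subst_combSkel (c c' : Bool) :
    (disjList (combSkel a c c')).subst (combSubst a T T' j b) =
      disjList (((cfList a).map fun X => neg (X.subst (combSubst a T T' j b))) ++
        [neg (hp a T (j + 1) b c), neg (hp a T' (j + 1) b c'), hp a (symmDiff T T') (j + 1) b (xor c c')]) := by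
  rw [combSkel, subst_disjList, List.map_append, List.map_map]
  simp only [List.map_cons, List.map_nil, PropForm.subst, subst_skel (show 0 ≤ 2 by norm_num),
    subst_skel (show 1 ≤ 2 by norm_num), subst_skel (show 2 ≤ 2 by norm_num)]
  rfl

end HierParity

end Literature.Computability.MetaComplexity
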